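/-
Adjudication Team R (D-0069 campaign, cell siegel-zhang; seat sz-d02 at Team R's grant of
2026-08-25T23:52Z): kernel certificate of the SECOND boundary seam of the skeleton deduction
`Ded22 c′` — the gap-distance seam `|w| = α(1 − c′α𝓛)` — INSUFFICIENCY-AS-TYPED AT THE SAME `c′`.
It complements Team R's first seam `σ = 1/2 + α²` (`AdjTeamRDed22Boundary.lean`, p411810). No
statement of the manuscript is refuted here; nothing here claims that `L(s,ψ)L(s,ψχ)` HAS a zero
in the boundary configuration, and nothing here is a claim about Siegel zeros or Theorems 1–2.
-/
import Literature.NumberTheory.LFunctions.Zhang2022.SkeletonPartOne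

/-! # Team R: the second `Ded22` seam — `|w| = α(1 − c′α𝓛)` (open annulus vs strict gap bound)

The manuscript deduces the restated gap assertion (iii) of Proposition 2.2 — "for some (large)
constant `c′ > 0`, `|γ′ − γ − α| < c′α²𝓛`" for consecutive zeros `½+iγ < ½+iγ′` of
`L(s,ψ)L(s,ψχ)` in `Ω` [cite: Zhang2022LandauSiegel, §2 p. 7, tex L455–L460] — from Lemma 4.6
("`𝒜(1/2+iγ+w,ψ) ≠ 0` if `0 < |w| < α(1−c′α𝓛)`", tex L1197–L1202) and Lemma 4.7 ("exactly three
zeros inside the circle `|w| = α(1+c′α𝓛)`", tex L1266): "To complete the proof of the gap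
assertion (iii), it now suffices to prove Lemma 4.7" [§4 p. 23, tex L1263–L1264]. The skeleton types
this as the CLAIM node `Skeleton.Ded22 c'` (`Lemma42 → Lemma45 → Lemma46 c' → Lemma47 c' →
Prop22 c'`, `SkeletonPartOne.lean`), with ONE constant `c′` on both sides.

THE SEAM. Lemma 4.6 (iii) as typed (`Skeleton.Lemma46 c'`) clears the OPEN punctured disc
`0 < |w| < α(1−c′α𝓛)` around a zero `ρ`; Lemma 4.7 (`Skeleton.Lemma47 c'`) counts the zeros in the
open disc `|w| < α(1+c′α𝓛)`; the conclusion `Skeleton.Prop22iii c'` demands the STRICT two-sided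
bound `|γ′ − γ − α| < c′α²𝓛`. A companion zero at the distance EXACTLY `v = α(1−c′α𝓛) = α − c′α²𝓛`
above `ρ` (purely imaginary shift `w = iv`) is
* NOT in the punctured disc of Lemma 4.6 (so Lemma 4.6 as typed says nothing about it),
* inside the counting disc of Lemma 4.7 (so it is one of the three counted zeros), and
* gives `γ′ − γ − α = −c′α²𝓛`, which VIOLATES the strict `<` of `Prop22iii c'` — while satisfying the
  `≤`-version and the strict version at any larger constant `c″ > c′`.
Hence `Ded22 c'` is not derivable from its four typed antecedents ALONE at the same `c′` (any
derivation would have to exclude this configuration, and none of the four antecedents does).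
REPAIRS (the ruling is the statement owners', sz-skel / sz-dag — cell GAP row G-d15-1 lists them):
(a) retype the lower side of (iii) with `≤` (`−c′α²𝓛 ≤ γ′ − γ − α < c′α²𝓛`), equivalently close the
punctured disc in Lemma 4.6 (iii) — Rouché's theorem on `|w| = α(1−c′α𝓛)` gives no zeros ON the
circle, so the closed form is what the printed proof yields; or (b) conclude `Prop22 c″` for any
`c″ > c′` (`Ded22′ c′ c″`) and re-thread `theorem1_of_leaves` at `c″` — downstream this is free:
`Skeleton.ded23_holds : 0 ≤ c → Ded23 c` for EVERY `c` (`Section2Lemma23Inputs.lean` p412474,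
`Section2Lemma23Holds.lean`).

The theorems below certify exactly the three bullet points, over the real objects `Skeleton.alpha`,
`Skeleton.ell` (hypotheses `0 < α`, `0 < 𝓛`, `0 < c′`, `c′α𝓛 < 1` — all true for every fixed
`c′ > 0` and all large `D`; an unconditional instance for `D ≥ 3`, `c′ = 1/𝓛` is not needed and not
given). `¬ Ded22` is NOT provable (the node is an implication between claims about the actual
`L`-functions) and is not asserted.
-/

open Complex Real

namespace Literature.NumberTheory.LFunctions.Zhang2022.AdjTeamR

open Literature.NumberTheory.LFunctions.Zhang2022.Skeleton

/-- The boundary shift `w = iα(1 − c′α𝓛)` has modulus `α(1 − c′α𝓛)` (for `c′α𝓛 ≤ 1`, `α ≥ 0`).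
[cite: Zhang2022LandauSiegel, §4 Lemma 4.6 p. 22] -/
theorem norm_boundary_shift (D : ℕ) {c' : ℝ} (hα : 0 ≤ alpha D) (h1 : c' * alpha D * ell D ≤ 1) :
    ‖((alpha D * (1 - c' * alpha D * ell D) : ℝ) : ℂ) * I‖ = alpha D * (1 - c' * alpha D * ell D) := by
  rw [norm_mul, Complex.norm_I, mul_one, Complex.norm_real,
    Real.norm_of_nonneg (mul_nonneg hα (by linarith))]

/-- **The second seam, bullet 1**: the boundary shift `w = iα(1−c′α𝓛)` does NOT satisfy the
hypothesis `0 < |w| < α(1−c′α𝓛)` of Lemma 4.6 (iii) as typed (`Skeleton.Lemma46 c'`: open punctured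
disc) — so Lemma 4.6 does not exclude a zero of `𝒜` at `ρ + w`.
[cite: Zhang2022LandauSiegel, §4 Lemma 4.6 p. 22, tex L1197–L1202] -/
theorem boundary_shift_not_in_open_annulus (D : ℕ) {c' : ℝ} (hα : 0 ≤ alpha D)
    (h1 : c' * alpha D * ell D ≤ 1) :
    ¬ (0 < ‖((alpha D * (1 - c' * alpha D * ell D) : ℝ) : ℂ) * I‖ ∧
        ‖((alpha D * (1 - c' * alpha D * ell D) : ℝ) : ℂ) * I‖ <
          alpha D * (1 - c' * alpha D * ell D)) := by
  rw [norm_boundary_shift D hα h1]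
  rintro ⟨-, h⟩
  exact lt_irrefl _ h

/-- **The second seam, bullet 2**: the boundary shift lies INSIDE the counting disc
`|w| < α(1+c′α𝓛)` of Lemma 4.7 (`Skeleton.Lemma47 c'`) once `c′ > 0`, `α > 0`, `𝓛 > 0` — a zero
there is one of the "exactly three". [cite: Zhang2022LandauSiegel, §4 Lemma 4.7 p. 23, tex L1266] -/
theorem boundary_shift_in_counting_disc (D : ℕ) {c' : ℝ} (hc' : 0 < c') (hα : 0 < alpha D)
    (hℓ : 0 < ell D) (h1 : c' * alpha D * ell D ≤ 1) :
    ‖((alpha D * (1 - c' * alpha D * ell D) : ℝ) : ℂ) * I‖ < alpha D * (1 + c' * alpha D * ell D) := by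
  rw [norm_boundary_shift D hα.le h1]
  have : 0 < c' * alpha D * ell D := by positivity
  nlinarith

/-- **The second seam, bullet 3**: a consecutive zero `ρ + w` at the boundary shift above any `ρ`
gives the height difference `γ′ − γ = α − c′α²𝓛`, which VIOLATES the strict bound
`|γ′ − γ − α| < c′α²𝓛` of `Skeleton.Prop22iii c'` — yet satisfies the `≤`-form (repair (a)) and the
strict form at every larger constant `c″ > c′` (repair (b)).
[cite: Zhang2022LandauSiegel, §2 p. 7, tex L455–L460] -/
theorem boundary_shift_violates_strict_gap (D : ℕ) {c' : ℝ} (hc' : 0 ≤ c') (hα : 0 < alpha D)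
    (hℓ : 0 < ell D) (ρ : ℂ) :
    let w : ℂ := ((alpha D * (1 - c' * alpha D * ell D) : ℝ) : ℂ) * I
    ¬ (|(ρ + w).im - ρ.im - alpha D| < c' * alpha D ^ 2 * ell D) ∧
      |(ρ + w).im - ρ.im - alpha D| ≤ c' * alpha D ^ 2 * ell D ∧
      ∀ c'' : ℝ, c' < c'' → |(ρ + w).im - ρ.im - alpha D| < c'' * alpha D ^ 2 * ell D := by
  intro w
  have him : (ρ + w).im - ρ.im - alpha D = -(c' * alpha D ^ 2 * ell D) := by
    simp [w]
    ring
  have he : 0 ≤ c' * alpha D ^ 2 * ell D := by positivity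
  have hpos : 0 < alpha D ^ 2 * ell D := by positivity
  rw [him, abs_neg, abs_of_nonneg he]
  refine ⟨lt_irrefl _, le_rfl, fun c'' hc'' => ?_⟩
  nlinarith

end Literature.NumberTheory.LFunctions.Zhang2022.AdjTeamR
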